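import Summits.ValiantsHypothesis.ValiantsHypothesis.Theorems.DivisionGapPerDivisionHardStubTorusFamily

/-!
# Crux `DivisionGap.PerDivisionHard` (stmt-ValiantsHypothesis-5065), line `pair-descent-jss-endpoint` —
stub `stub_atomicTop`: the top fibre of an atomic expression, atom by atom

An ATOMIC EXPRESSION over `ℝ≥0[x_ij]` is `h = Σ_{l ∈ L} a_l · x^{C_l} · ∏_{β ∈ I} F_β^{μ_l(β)}`
(terms `l`: a monomial prefactor times a product of powers of shared atoms `F_β`).
`stub_atomicTop`: every monomial `m` of the top-`w` fibre `top_w h` comes from one term `l` and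
decomposes as `m = C_l + Σ_{β ∈ I} Σ_{j < μ_l(β)} f_{β,j}` with EVERY `f_{β,j}` in the top-`w`
fibre of the atom `F_β`.

Proof.  Over `ℝ≥0` the support of a positive combination is the union of the supports of its
effective summands (`MvPolynomial.support_sum` for `⊆`; `support_subset_support_finset_sum` for
`⊇`), so `m ∈ supp (term l)` for some `l ∈ L` with `a_l ≠ 0`, and `wdeg (term l) ≤ wdeg h =
weight m`, i.e. `m ∈ supp (top_w (term l))`.  Top components are multiplicative over `ℝ≥0`
(`topComponent_mul`, `topComponent_finset_prod` — this is where "no cancellation" enters: the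
support of a product is the full sumset), so
`top_w (term l) = x^{C_l} · ∏_{(β, j)} top_w F_β` over the index set `I.sigma (range ∘ μ_l)`, and
the support of a finite product lies in the sumset of the supports
(`exists_eq_sum_of_mem_support_finset_prod`). [folklore]
-/

noncomputable section

-- `Summit.ValiantsHypothesis.ValiantsHypothesis.…` is the tree's mandated single-conjunct layout
-- (Sub = Summit), so the duplicated namespace component is intended.
set_option linter.dupNamespace false

namespace Summit.ValiantsHypothesis.ValiantsHypothesis.Theorems.DivisionGapPerDivisionHard

open MvPolynomial Literature.Computability.AlgebraicComplexity
open Literature.Barriers.ValiantsHypothesis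
open Summit.ValiantsHypothesis.ValiantsHypothesis.Theorems.ZeroOneTransfer.Negative
open scoped NNReal Pointwise

/-! ### Supports of finite products and positive sums -/

/-- A monomial of a finite product of polynomials is a sum of monomials of the factors (any
commutative semiring: `support_mul ⊆ support + support`, iterated). [folklore] -/
theorem exists_eq_sum_of_mem_support_finset_prod {σ α R : Type*} [CommSemiring R] (s : Finset α)
    (G : α → MvPolynomial σ R) {m : σ →₀ ℕ} (hm : m ∈ (∏ x ∈ s, G x).support) :
    ∃ g : α → σ →₀ ℕ, (∀ x ∈ s, g x ∈ (G x).support) ∧ m = ∑ x ∈ s, g x := by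
  classical
  induction s using Finset.induction_on generalizing m with
  | empty =>
    refine ⟨fun _ => 0, fun x hx => absurd hx (Finset.notMem_empty x), ?_⟩
    rw [Finset.prod_empty, one_def] at hm
    rw [Finset.sum_empty]
    exact Finset.mem_singleton.1 (support_monomial_subset hm)
  | insert a s ha ih =>
    rw [Finset.prod_insert ha] at hm
    obtain ⟨x, hx, y, hy, rfl⟩ := Finset.mem_add.1 (support_mul _ _ hm)
    obtain ⟨g, hg, rfl⟩ := ih hy
    refine ⟨Function.update g a x, fun b hb => ?_, ?_⟩
    · rcases Finset.mem_insert.1 hb with rfl | hb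
      · rwa [Function.update_self]
      · rw [Function.update_of_ne (ne_of_mem_of_not_mem hb ha)]
        exact hg b hb
    · rw [Finset.sum_insert ha, Function.update_self]
      congr 1
      exact Finset.sum_congr rfl fun b hb => by
        rw [Function.update_of_ne (ne_of_mem_of_not_mem hb ha)]

/-- Over `ℝ≥0` (no cancellation) the support of a summand lies in the support of a finite sum.
[folklore] -/
theorem support_subset_support_finset_sum {σ α : Type*} (s : Finset α)
    (g : α → MvPolynomial σ ℝ≥0) {x : α} (hx : x ∈ s) :
    (g x).support ⊆ (∑ y ∈ s, g y).support := by
  intro m hm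
  rw [mem_support_iff] at hm ⊢
  rw [coeff_sum]
  exact (lt_of_lt_of_le (pos_iff_ne_zero.mpr hm)
    (Finset.single_le_sum (f := fun y => coeff m (g y)) (fun _ _ => zero_le) hx)).ne'

/-- Membership in a top fibre: a monomial of `p` whose weight is the weighted degree of `p`.
[folklore] -/
theorem mem_support_topComponent_iff_weight {σ : Type*} (w : σ → ℕ) (p : MvPolynomial σ ℝ≥0)
    (d : σ →₀ ℕ) :
    d ∈ (topComponent w p).support ↔
      d ∈ p.support ∧ Finsupp.weight w d = weightedTotalDegree w p := by
  rw [mem_support_iff, coeff_topComponent, mem_support_iff]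
  split_ifs with h
  · exact ⟨fun hd => ⟨hd, h⟩, fun hd => hd.1⟩
  · exact ⟨fun hd => absurd rfl hd, fun hd => absurd hd.2 h⟩

/-- A product of powers as one product over the sigma index set `{(a, j) : a ∈ s, j < e a}`.
[folklore] -/
theorem prod_pow_eq_prod_sigma {M α : Type*} [CommMonoid M] (s : Finset α) (x : α → M)
    (e : α → ℕ) :
    ∏ a ∈ s, x a ^ e a = ∏ p ∈ s.sigma (fun a => Finset.range (e a)), x p.1 :=
  (Finset.prod_congr rfl fun a _ => Finset.pow_eq_prod_const (x a) (e a)).trans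
    (Finset.prod_sigma' s (fun a => Finset.range (e a)) fun a _ => x a)

/-! ### The stub -/

/-- **`stub_atomicTop`.**  Every monomial of the top-`w` fibre of an atomic expression
`Σ_{l ∈ L} a_l · x^{C_l} · ∏_{β ∈ I} F_β^{μ_l(β)}` comes from one term `l` with ALL atom monomials
taken from the top-`w` fibres of the atoms:
`m = C_l + Σ_{β ∈ I} Σ_{j < μ_l(β)} f_{β,j}`, `f_{β,j} ∈ supp (top_w F_β)`.  (Support of a
positive combination is the union, so `m` is a top monomial of one effective term; top components
are multiplicative over `ℝ≥0`, and the support of a product lies in the sumset of the supports.)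
[folklore] -/
theorem stub_atomicTop :
    ∀ (n : ℕ) (ι κ : Type) (I : Finset ι) (L : Finset κ)
      (F : ι → MvPolynomial (Fin n × Fin n) ℝ≥0) (a : κ → ℝ≥0) (C : κ → (Fin n × Fin n) →₀ ℕ)
      (μ : κ → ι → ℕ) (w : Fin n × Fin n → ℕ) (m : (Fin n × Fin n) →₀ ℕ),
      m ∈ (topComponent w
        (∑ l ∈ L, a l • (monomial (C l) (1 : ℝ≥0) * ∏ β ∈ I, F β ^ μ l β))).support →
      ∃ l ∈ L, ∃ f : ι → ℕ → ((Fin n × Fin n) →₀ ℕ),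
        (∀ β ∈ I, ∀ j < μ l β, f β j ∈ (topComponent w (F β)).support) ∧
        m = C l + ∑ β ∈ I, ∑ j ∈ Finset.range (μ l β), f β j := by
  intro n ι κ I L F a C μ w m hm
  classical
  obtain ⟨hmh, hwm⟩ := (mem_support_topComponent_iff_weight w _ m).1 hm
  -- `m` is a monomial of one effective term `l`
  obtain ⟨l, hl, hml⟩ :
      ∃ l ∈ L, m ∈ (a l • (monomial (C l) (1 : ℝ≥0) * ∏ β ∈ I, F β ^ μ l β)).support :=
    Finset.mem_biUnion.1 (MvPolynomial.support_sum hmh)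
  have hal : a l ≠ 0 := by
    rintro h0
    rw [h0, zero_smul, support_zero] at hml
    exact Finset.notMem_empty m hml
  rw [JerrumSnir.support_smul_eq hal] at hml
  -- ... and lies in the top fibre of that term
  have hmT : m ∈ (topComponent w
      (monomial (C l) (1 : ℝ≥0) * ∏ β ∈ I, F β ^ μ l β)).support := by
    refine (mem_support_topComponent_iff_weight w _ m).2
      ⟨hml, le_antisymm (le_weightedTotalDegree w hml) ?_⟩
    rw [hwm]
    refine Finset.sup_mono ?_
    rw [← JerrumSnir.support_smul_eq hal (monomial (C l) (1 : ℝ≥0) * ∏ β ∈ I, F β ^ μ l β)]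
    exact support_subset_support_finset_sum L
      (fun x => a x • (monomial (C x) (1 : ℝ≥0) * ∏ β ∈ I, F β ^ μ x β)) hl
  -- split off the monomial prefactor and index the atom occurrences by `I.sigma (range ∘ μ l)`
  rw [topComponent_mul, prod_pow_eq_prod_sigma I F (μ l), topComponent_finset_prod] at hmT
  obtain ⟨c, hc, p, hp, rfl⟩ := Finset.mem_add.1 (support_mul _ _ hmT)
  have hcC : c = C l :=
    Finset.mem_singleton.1 (support_monomial_subset (support_topComponent_subset w _ hc))
  obtain ⟨g, hg, rfl⟩ := exists_eq_sum_of_mem_support_finset_prod _ _ hp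
  refine ⟨l, hl, fun β j => g ⟨β, j⟩, fun β hβ j hj =>
    hg ⟨β, j⟩ (Finset.mem_sigma.2 ⟨hβ, Finset.mem_range.2 hj⟩), ?_⟩
  rw [hcC, Finset.sum_sigma]

end Summit.ValiantsHypothesis.ValiantsHypothesis.Theorems.DivisionGapPerDivisionHard

end
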